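import Mathlib

/-!
# Clause 13-J/13-R, model step C7a (CLAUSE SCALING, elementary bounds): the constants of `model_l2_estimate_closed` in the regime
# `G ≍ Γ`, `R = R_b√(Γ log Γ)`, `x_s = Γ^{-1/8}`, `X = 4 log Γ`, `θ = θ₀/R`, `η = η₀`

Route `FilamentSkeletonRss`, ∃-side clause 13 (`Clause13RNearStraightL`, stmt-NavierStokesRegularity-23612; typing-agnostic); design
`filament-plan/DESIGN-28296-model-L2closed-and-Linfty-g17.md` §2.  The closed model estimate (`model_l2_estimate_closed`, p710825) holds under the
smallness condition `6(δ₁+δ₂+2δ₃+δ₅+δ₆) ≤ ½` with explicit `δ_s`, `α_s`.  This file is the pure real-inequality bookkeeping showing that in the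
clause scaling — written in the atoms `t = Γ^{1/8} ≥ 1`, `s = log Γ ≥ 1`, `s ≤ 8t`, `g t⁸ ≤ G ≤ g′ t⁸`, `R = R_b t⁴ √s`, `x_s = 1/t`, `X = 4s`,
`L₁ + L₂ ≤ l/t²` — every `δ_s` is `≤ (Γ-free constant)/t`, `/s`, or (for the ball piece) `1/2400 + R_b·M`, and every `α_s` is bounded Γ-uniformly
(§1), and that for `t ≥ T_min`, `s ≥ S_min`, `R_b ≤ 1/(200 M + 1)` the smallness condition holds with `12Σα ≤ A` (§2, `scaling_smallness`).
No analysis here; the `Γ`-dictionary (`t⁸ = Γ`, …) and the model theorem are applied in `…Clause13ModelScaled`.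
Lane ns-filament-19175-p1 g17; `--supports stmt-NavierStokesRegularity-23612 --as helper`.
HONEST FRAMING: bookkeeping about an explicit 1-D model operator attached to a HYPOTHETICAL filament skeleton on the NEGATIVE side of a MODEL route;
nothing here bears on Navier–Stokes regularity or blow-up.
-/

noncomputable section

open Real

namespace Summit.NavierStokesRegularity.NavierStokesRegularity.Theorems.MatchedKernel
set_option linter.dupNamespace false

/-! ## §0 Small facts -/

/-- `G ≥ g t⁸`, `t ≥ 1`, `g > 0` ⟹ `0 < G`, `g ≤ G`, `g t ≤ G`, `g t⁶ ≤ G`. -/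
theorem scl_G {g t G : ℝ} (hg : 0 < g) (ht : 1 ≤ t) (hG : g * t ^ 8 ≤ G) : 0 < G ∧ g ≤ G ∧ g * t ≤ G ∧ g * t ^ 6 ≤ G := by
  have ht8 : t ≤ t ^ 8 := le_self_pow₀ ht (by norm_num)
  have h68 : t ^ 6 ≤ t ^ 8 := pow_le_pow_right₀ ht (by norm_num)
  have h1 : (1 : ℝ) ≤ t ^ 8 := one_le_pow₀ ht
  refine ⟨?_, ?_, ?_, ?_⟩ <;> nlinarith

/-! ## §1 The pieces one by one -/

/-- `ε = b₂q/(4G) ≤ (b₂q/(4g))/t`. -/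
theorem scl_eps {q g t G b₂ ε : ℝ} (hq : 0 < q) (hg : 0 < g) (hb₂ : 0 ≤ b₂) (ht : 1 ≤ t) (hG : g * t ^ 8 ≤ G)
    (eε : ε = b₂ * q / (4 * G)) : 0 ≤ ε ∧ ε ≤ b₂ * q / (4 * g) / t ∧ ε * G = b₂ * q / 4 := by
  obtain ⟨hG0, -, hGt, -⟩ := scl_G hg ht hG
  have ht0 : 0 < t := by linarith
  refine ⟨by rw [eε]; positivity, ?_, ?_⟩
  · rw [eε, div_div, div_le_div_iff₀ (by positivity) (by positivity)]
    have := mul_nonneg hb₂ hq.le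
    nlinarith [mul_le_mul_of_nonneg_left hGt this]
  · calc ε * G = b₂ * q / 4 * (G / G) := by rw [eε]; ring
      _ = b₂ * q / 4 := by rw [div_self hG0.ne', mul_one]

/-- `cH ≤ M_cH/t` (`e^{-X/2} = 1/t¹⁶`, `ε ≤ ½`). -/
theorem scl_cH {q g g' t G b₁ b₂ ε eX cH : ℝ} (hq : 0 < q) (hg : 0 < g) (hb₁ : 0 ≤ b₁) (hb₂ : 0 ≤ b₂) (ht : 1 ≤ t)
    (hG : g * t ^ 8 ≤ G) (hG' : G ≤ g' * t ^ 8) (eε : ε = b₂ * q / (4 * G)) (hε : ε ≤ 1 / 2) (heX : eX = 1 / t ^ 16)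
    (ecH : cH = (1 + ε) * G * (2 / q * (5 * eX)) + 2 * b₁ * ε + 2 * (2 * G / q) * ε ^ 2) :
    0 ≤ cH ∧ cH ≤ (15 * g' / q + b₁ * b₂ * q / (2 * g) + b₂ ^ 2 * q / (4 * g)) / t := by
  obtain ⟨hε0, hεb, hεG⟩ := scl_eps hq hg hb₂ ht hG eε
  obtain ⟨hG0, -, hGt, -⟩ := scl_G hg ht hG
  have ht0 : 0 < t := by linarith
  have hg' : 0 < g' := by
    have h := hG.trans hG'
    have := le_of_mul_le_mul_right h (by positivity); linarith
  constructor
  · rw [ecH, heX]; positivity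
  have h1 : (1 + ε) * G * (2 / q * (5 * eX)) ≤ 15 * g' / q / t := by
    have hGt16 : G / t ^ 16 ≤ g' / t := by
      rw [div_le_div_iff₀ (by positivity) (by positivity)]
      calc G * t ≤ g' * t ^ 8 * t ^ 8 := by
            nlinarith [mul_le_mul_of_nonneg_left (le_self_pow₀ ht (by norm_num : (8 : ℕ) ≠ 0)) hG0.le,
              mul_le_mul_of_nonneg_right hG' (by positivity : (0 : ℝ) ≤ t ^ 8)]
        _ = g' * t ^ 16 := by ring
    calc (1 + ε) * G * (2 / q * (5 * eX)) = ((1 + ε) * (10 / q)) * (G / t ^ 16) := by rw [heX]; ring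
      _ ≤ (3 / 2 * (10 / q)) * (g' / t) :=
          mul_le_mul (mul_le_mul_of_nonneg_right (by linarith) (by positivity)) hGt16 (by positivity) (by positivity)
      _ = 15 * g' / q / t := by ring
  have h2 : 2 * b₁ * ε ≤ b₁ * b₂ * q / (2 * g) / t := by
    calc 2 * b₁ * ε ≤ 2 * b₁ * (b₂ * q / (4 * g) / t) := by gcongr
      _ = _ := by ring
  have h3 : 2 * (2 * G / q) * ε ^ 2 ≤ b₂ ^ 2 * q / (4 * g) / t := by
    have e : 2 * (2 * G / q) * ε ^ 2 = b₂ * ε := by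
      calc 2 * (2 * G / q) * ε ^ 2 = 4 / q * (ε * G) * ε := by ring
        _ = 4 / q * (b₂ * q / 4) * ε := by rw [hεG]
        _ = b₂ * ε * (q / q) := by ring
        _ = b₂ * ε := by rw [div_self hq.ne', mul_one]
    rw [e]
    calc b₂ * ε ≤ b₂ * (b₂ * q / (4 * g) / t) := by gcongr
      _ = _ := by ring
  rw [ecH]
  have e : (15 * g' / q + b₁ * b₂ * q / (2 * g) + b₂ ^ 2 * q / (4 * g)) / t
      = 15 * g' / q / t + b₁ * b₂ * q / (2 * g) / t + b₂ ^ 2 * q / (4 * g) / t := by ring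
  rw [e]; linarith

/-- `CF ≤ M_CF/s` (`X = 4s`). -/
theorem scl_CF {C q Λ₂ l t s X L₁ L₂ CF : ℝ} (hC : 0 ≤ C) (hΛ₂ : 0 ≤ Λ₂) (hl : 0 ≤ l) (ht : 1 ≤ t) (hs : 1 ≤ s)
    (hX : X = 4 * s) (hL₁ : 0 ≤ L₁) (hL₂ : 0 ≤ L₂) (hL : L₁ + L₂ ≤ l / t ^ 2)
    (eCF : CF = Λ₂ * ((C * √q / X) + (C * √q / X)) + (L₁ + L₂) * (C * √q / X)) :
    0 ≤ CF ∧ CF ≤ (2 * Λ₂ + l) * C * √q / 4 / s := by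
  have hs0 : 0 < s := by linarith
  have hLl : L₁ + L₂ ≤ l := hL.trans (div_le_self hl (one_le_pow₀ ht))
  have hL0 : 0 ≤ L₁ + L₂ := by linarith
  have e : CF = (2 * Λ₂ + (L₁ + L₂)) * (C * √q) / (4 * s) := by rw [eCF, hX]; ring
  rw [e]
  refine ⟨div_nonneg (mul_nonneg (by linarith) (by positivity)) (by linarith), ?_⟩
  rw [div_div, div_le_div_iff₀ (by positivity) (by positivity)]
  have hcs : 0 ≤ C * √q * (4 * s) := by positivity
  nlinarith [mul_le_mul_of_nonneg_right hLl hcs]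

/-- `ℓ·Λ·RW ≤ M_ℓRW/t`. -/
theorem scl_lRW {C q g Λ l t s G R Rb X L₁ L₂ ℓ RW : ℝ} (hC : 0 ≤ C) (hq : 0 < q) (hg : 0 < g) (hΛ : 0 ≤ Λ) (hl : 0 ≤ l)
    (ht : 1 ≤ t) (hs : 1 ≤ s) (hst : s ≤ 8 * t) (hG : g * t ^ 8 ≤ G) (hRb : 0 ≤ Rb) (hRb1 : Rb ≤ 1)
    (hR : R = Rb * t ^ 4 * Real.sqrt s) (hX : X = 4 * s) (hL₁ : 0 ≤ L₁) (hL₂ : 0 ≤ L₂) (hL : L₁ + L₂ ≤ l / t ^ 2)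
    (eℓ : ℓ = L₂ * q / (4 * G)) (eRW : RW = R + Real.sqrt 2 * (C * R + (C * √q / X))) :
    0 ≤ ℓ * Λ * RW ∧ ℓ * Λ * RW ≤ Λ * l * q * (8 * (1 + 2 * C) + C * √q) / (4 * g) / t := by
  obtain ⟨hG0, -, -, -⟩ := scl_G hg ht hG
  have ht0 : 0 < t := by linarith
  have hs0 : 0 < s := by linarith
  have h2 : Real.sqrt 2 ≤ 2 := by rw [Real.sqrt_le_left (by norm_num)]; norm_num
  have hss : Real.sqrt s ≤ s := by rw [Real.sqrt_le_left (by linarith)]; nlinarith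
  have hR0 : 0 ≤ R := by rw [hR]; positivity
  have hRW0 : 0 ≤ RW := by rw [eRW, hX]; positivity
  have hℓ0 : 0 ≤ ℓ := by rw [eℓ]; positivity
  refine ⟨by positivity, ?_⟩
  have hL₂' : L₂ * t ^ 2 ≤ l := by
    have : L₂ ≤ l / t ^ 2 := by linarith
    rwa [le_div_iff₀ (by positivity)] at this
  have hℓ : ℓ ≤ l * q / (4 * g * t ^ 10) := by
    rw [eℓ, div_le_div_iff₀ (by positivity) (by positivity)]
    calc L₂ * q * (4 * g * t ^ 10) = 4 * q * ((L₂ * t ^ 2) * (g * t ^ 8)) := by ring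
      _ ≤ 4 * q * (l * G) := by gcongr
      _ = l * q * (4 * G) := by ring
  have hRle : R ≤ 8 * t ^ 5 := by
    rw [hR]
    calc Rb * t ^ 4 * Real.sqrt s ≤ 1 * t ^ 4 * (8 * t) :=
          mul_le_mul (mul_le_mul_of_nonneg_right hRb1 (by positivity)) (hss.trans hst) (Real.sqrt_nonneg _) (by positivity)
      _ = 8 * t ^ 5 := by ring
  have ht5 : (1 : ℝ) ≤ t ^ 5 := one_le_pow₀ ht
  have hRW : RW ≤ (8 * (1 + 2 * C) + C * √q) * t ^ 5 := by
    rw [eRW, hX]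
    have hA : Real.sqrt 2 * (C * R) ≤ 2 * (C * (8 * t ^ 5)) :=
      mul_le_mul h2 (mul_le_mul_of_nonneg_left hRle hC) (by positivity) (by norm_num)
    have hB : Real.sqrt 2 * (C * √q / (4 * s)) ≤ 2 * (C * √q / 4) := by
      refine mul_le_mul h2 ?_ (by positivity) (by norm_num)
      exact div_le_div_of_nonneg_left (by positivity) (by norm_num) (by linarith)
    have hCq : 0 ≤ C * √q := by positivity
    calc R + Real.sqrt 2 * (C * R + C * √q / (4 * s))
        = R + (Real.sqrt 2 * (C * R) + Real.sqrt 2 * (C * √q / (4 * s))) := by ring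
      _ ≤ 8 * t ^ 5 + (2 * (C * (8 * t ^ 5)) + 2 * (C * √q / 4)) := add_le_add hRle (add_le_add hA hB)
      _ ≤ (8 * (1 + 2 * C) + C * √q) * t ^ 5 := by nlinarith [mul_le_mul_of_nonneg_left ht5 hCq]
  calc ℓ * Λ * RW ≤ (l * q / (4 * g * t ^ 10)) * Λ * ((8 * (1 + 2 * C) + C * √q) * t ^ 5) :=
        mul_le_mul (mul_le_mul_of_nonneg_right hℓ hΛ) hRW hRW0 (by positivity)
    _ = Λ * l * q * (8 * (1 + 2 * C) + C * √q) / (4 * g) / t * (1 / t ^ 4) := by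
        field_simp
    _ ≤ Λ * l * q * (8 * (1 + 2 * C) + C * √q) / (4 * g) / t := by
        refine mul_le_of_le_one_right (by positivity) ?_
        rw [div_le_one (by positivity)]; exact one_le_pow₀ ht

/-- `αT = α₅ = 25qC²/G ≤ 25qC²/g` and `≤ (25qC²/g)/t`. -/
theorem scl_alphaT {C q g t G αT : ℝ} (hq : 0 < q) (hg : 0 < g) (ht : 1 ≤ t) (hG : g * t ^ 8 ≤ G)
    (eαT : αT = C ^ 2 / (G * (2 / q * (1 / 50)))) :
    0 ≤ αT ∧ αT ≤ 25 * q * C ^ 2 / g ∧ αT ≤ 25 * q * C ^ 2 / g / t := by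
  obtain ⟨hG0, hGg, hGt, -⟩ := scl_G hg ht hG
  have ht0 : 0 < t := by linarith
  have e : αT = 25 * q * C ^ 2 / G := by rw [eαT]; field_simp; ring
  rw [e]
  refine ⟨by positivity, div_le_div_of_nonneg_left (by positivity) hg hGg, ?_⟩
  rw [div_div]; exact div_le_div_of_nonneg_left (by positivity) (by positivity) hGt

/-- The shape shared by `δT` and `δ₅`: `≤ M_δT/t`. (`Lt` is the `L`-term, `≤ l·C√q`.) -/
theorem scl_deltaT {C q g Λ l b₁ b₂ t s G R Rb X Lt δ : ℝ} (hC : 0 ≤ C) (hq : 0 < q) (hg : 0 < g) (hΛ : 0 ≤ Λ) (hl : 0 ≤ l)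
    (hb₁ : 0 ≤ b₁) (hb₂ : 0 ≤ b₂) (ht : 1 ≤ t) (hs : 1 ≤ s) (hst : s ≤ 8 * t) (hG : g * t ^ 8 ≤ G) (hRb : 0 ≤ Rb) (hRb1 : Rb ≤ 1)
    (hR : R = Rb * t ^ 4 * Real.sqrt s) (hX : X = 4 * s) (hLt0 : 0 ≤ Lt) (hLt : Lt ≤ l * (C * √q))
    (eδ : δ = ((Λ * (C + C) + Lt + (b₁ + b₂) * C + Real.sqrt 2 * Λ * C) + Real.sqrt 2 * Λ * (C * X / √q) * R) * C
      / (G * (2 / q * (1 / 50)))) :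
    0 ≤ δ ∧ δ ≤ (25 * q * (4 * Λ + l * √q + b₁ + b₂) * C ^ 2 / g + 12800 * Λ * C ^ 2 * √q / g) / t := by
  obtain ⟨hG0, -, hGt, -⟩ := scl_G hg ht hG
  have ht0 : 0 < t := by linarith
  have hs0 : 0 < s := by linarith
  have h2 : Real.sqrt 2 ≤ 2 := by rw [Real.sqrt_le_left (by norm_num)]; norm_num
  have hsq : 0 < √q := Real.sqrt_pos.2 hq
  have hss : Real.sqrt s ≤ s := by rw [Real.sqrt_le_left (by linarith)]; nlinarith
  have hR0 : 0 ≤ R := by rw [hR]; positivity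
  refine ⟨by rw [eδ, hX]; positivity, ?_⟩
  have hN1 : Λ * (C + C) + Lt + (b₁ + b₂) * C + Real.sqrt 2 * Λ * C ≤ (4 * Λ + l * √q + b₁ + b₂) * C := by
    have hΛC := mul_nonneg hΛ hC
    nlinarith [mul_le_mul_of_nonneg_right h2 hΛC]
  have hs2 : s * Real.sqrt s ≤ 64 * t ^ 2 :=
    calc s * Real.sqrt s ≤ s * s := mul_le_mul_of_nonneg_left hss hs0.le
      _ ≤ (8 * t) * (8 * t) := mul_le_mul hst hst hs0.le (by positivity)
      _ = 64 * t ^ 2 := by ring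
  have hN2 : Real.sqrt 2 * Λ * (C * X / √q) * R ≤ 512 * Λ * C * t ^ 6 / √q := by
    rw [hX, hR]
    calc Real.sqrt 2 * Λ * (C * (4 * s) / √q) * (Rb * t ^ 4 * Real.sqrt s)
        = Real.sqrt 2 * Rb * (s * Real.sqrt s) * (4 * Λ * C * t ^ 4 / √q) := by ring
      _ ≤ 2 * 1 * (64 * t ^ 2) * (4 * Λ * C * t ^ 4 / √q) := by gcongr
      _ = 512 * Λ * C * t ^ 6 / √q := by ring
  have hden : G * (2 / q * (1 / 50)) = G / (25 * q) := by ring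
  rw [eδ, hden]
  have hA : (Λ * (C + C) + Lt + (b₁ + b₂) * C + Real.sqrt 2 * Λ * C) * C / (G / (25 * q))
      ≤ (4 * Λ + l * √q + b₁ + b₂) * C * C / (g * t / (25 * q)) :=
    div_le_div₀ (by positivity) (mul_le_mul_of_nonneg_right hN1 hC) (by positivity) (by gcongr)
  have hB : Real.sqrt 2 * Λ * (C * X / √q) * R * C / (G / (25 * q)) ≤ (512 * Λ * C * t ^ 6 / √q) * C / (g * t ^ 8 / (25 * q)) :=
    div_le_div₀ (by positivity) (mul_le_mul_of_nonneg_right hN2 hC) (by positivity) (by gcongr)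
  have eA : (4 * Λ + l * √q + b₁ + b₂) * C * C / (g * t / (25 * q)) = 25 * q * (4 * Λ + l * √q + b₁ + b₂) * C ^ 2 / g / t := by
    field_simp
  have eB : (512 * Λ * C * t ^ 6 / √q) * C / (g * t ^ 8 / (25 * q)) = 12800 * Λ * C ^ 2 * (q / √q) / g * (1 / t ^ 2) := by
    field_simp; ring
  have hB' : 12800 * Λ * C ^ 2 * (q / √q) / g * (1 / t ^ 2) ≤ 12800 * Λ * C ^ 2 * √q / g / t := by
    rw [Real.div_sqrt, div_eq_mul_one_div (12800 * Λ * C ^ 2 * √q / g) t]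
    refine mul_le_mul_of_nonneg_left ?_ (by positivity)
    exact div_le_div_of_nonneg_left zero_le_one ht0 (le_self_pow₀ ht (by norm_num))
  have esplit : ((Λ * (C + C) + Lt + (b₁ + b₂) * C + Real.sqrt 2 * Λ * C) + Real.sqrt 2 * Λ * (C * X / √q) * R) * C / (G / (25 * q))
      = (Λ * (C + C) + Lt + (b₁ + b₂) * C + Real.sqrt 2 * Λ * C) * C / (G / (25 * q))
        + Real.sqrt 2 * Λ * (C * X / √q) * R * C / (G / (25 * q)) := by ring
  rw [esplit, add_div]
  rw [eA] at hA; rw [eB] at hB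
  exact add_le_add hA (hB.trans hB')

set_option maxHeartbeats 400000 in
/-- FAR piece: `α₆ ≤ M_α₆`, `δ₆ ≤ 1/4800 + M/t + M′/s` (`ε ≤ ½`, `η = β₀/(21600(1+C)Λ+1)`), from the bounds on `αT, δT, CF, cH, ℓΛRW`. -/
theorem scl_delta6 {C Λ β₀ t s ε η αT δT CF cH ℓ RW MαT MδT MCF McH MlRW α₆ δ₆ : ℝ} (hC : 0 ≤ C) (hΛ : 0 ≤ Λ)
    (hβ₀ : 0 < β₀) (ht : 1 ≤ t) (hs : 1 ≤ s) (hε0 : 0 ≤ ε) (hε : ε ≤ 1 / 2) (hη : η = β₀ / (21600 * (1 + C) * Λ + 1))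
    (hαT0 : 0 ≤ αT) (hαT : αT ≤ MαT) (hδT0 : 0 ≤ δT) (hδT : δT ≤ MδT / t) (hCF0 : 0 ≤ CF) (hCF : CF ≤ MCF / s)
    (hcH0 : 0 ≤ cH) (hcH : cH ≤ McH / t) (hlRW0 : 0 ≤ ℓ * Λ * RW) (hlRW : ℓ * Λ * RW ≤ MlRW / t)
    (eα₆ : α₆ = (1 + ε) ^ 2 * (1 + C) * ((1 + C) + Λ * αT / (2 * η)) / (β₀ * (1 - ε) ^ 2))
    (eδ₆ : δ₆ = ((1 + ε) ^ 2 * (1 + C) * Λ * (δT / (2 * η) + η / 2)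
      + (1 + ε) * (1 + C) * ((1 + ε) * CF + cH * (1 + C) + ℓ * Λ * RW)) / (β₀ * (1 - ε) ^ 2)) :
    0 < η ∧ 0 ≤ α₆ ∧ α₆ ≤ 9 * (1 + C) * ((1 + C) + Λ * MαT / (2 * η)) / β₀ ∧ 0 ≤ δ₆ ∧
      δ₆ ≤ 1 / 4800 + (9 * (1 + C) * Λ * MδT / (2 * η * β₀) + 6 * (1 + C) ^ 2 * McH / β₀ + 6 * (1 + C) * MlRW / β₀) / t
        + 9 * (1 + C) * MCF / β₀ / s := by
  have ht0 : 0 < t := by linarith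
  have hs0 : 0 < s := by linarith
  have hη0 : 0 < η := by rw [hη]; positivity
  have h1e : (1 + ε) ^ 2 ≤ 9 / 4 := by nlinarith
  have h1e1 : 1 + ε ≤ 3 / 2 := by linarith
  have h14 : (1 : ℝ) / 4 ≤ (1 - ε) ^ 2 := by
    have ha : 0 ≤ 1 - ε - 1 / 2 := by linarith
    have hb : 0 ≤ 1 - ε + 1 / 2 := by linarith
    nlinarith [mul_nonneg ha hb]
  have h1e' : β₀ / 4 ≤ β₀ * (1 - ε) ^ 2 := by
    have := mul_le_mul_of_nonneg_left h14 hβ₀.le; linarith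
  have hden0 : 0 < β₀ * (1 - ε) ^ 2 := lt_of_lt_of_le (by positivity) h1e'
  have hMδT : 0 ≤ MδT := by have := hδT0.trans hδT; rw [le_div_iff₀ ht0] at this; linarith
  have hMCF : 0 ≤ MCF := by have := hCF0.trans hCF; rw [le_div_iff₀ hs0] at this; linarith
  have hMcH : 0 ≤ McH := by have := hcH0.trans hcH; rw [le_div_iff₀ ht0] at this; linarith
  have hMlRW : 0 ≤ MlRW := by have := hlRW0.trans hlRW; rw [le_div_iff₀ ht0] at this; linarith
  have hMαT : 0 ≤ MαT := hαT0.trans hαT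
  refine ⟨hη0, by rw [eα₆]; positivity, ?_, by rw [eδ₆]; positivity, ?_⟩
  · rw [eα₆]
    have hnum : (1 + ε) ^ 2 * (1 + C) * ((1 + C) + Λ * αT / (2 * η)) ≤ 9 / 4 * ((1 + C) * ((1 + C) + Λ * MαT / (2 * η))) := by
      rw [mul_assoc]
      refine mul_le_mul h1e ?_ (by positivity) (by norm_num)
      gcongr
    calc (1 + ε) ^ 2 * (1 + C) * ((1 + C) + Λ * αT / (2 * η)) / (β₀ * (1 - ε) ^ 2)
        ≤ 9 / 4 * ((1 + C) * ((1 + C) + Λ * MαT / (2 * η))) / (β₀ / 4) := div_le_div₀ (by positivity) hnum (by positivity) h1e'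
      _ = _ := by field_simp
  · rw [eδ₆]
    have hA : (1 + ε) ^ 2 * (1 + C) * Λ * (δT / (2 * η) + η / 2) ≤ 9 / 4 * ((1 + C) * Λ * (MδT / t / (2 * η) + η / 2)) := by
      have e : (1 + ε) ^ 2 * (1 + C) * Λ * (δT / (2 * η) + η / 2) = (1 + ε) ^ 2 * ((1 + C) * Λ * (δT / (2 * η) + η / 2)) := by
        ring
      rw [e]
      refine mul_le_mul h1e ?_ (by positivity) (by norm_num)
      gcongr
    have hB : (1 + ε) * (1 + C) * ((1 + ε) * CF + cH * (1 + C) + ℓ * Λ * RW)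
        ≤ 3 / 2 * (1 + C) * (3 / 2 * (MCF / s) + McH / t * (1 + C) + MlRW / t) := by
      refine mul_le_mul (mul_le_mul_of_nonneg_right h1e1 (by positivity)) ?_ (by positivity) (by positivity)
      exact add_le_add (add_le_add (mul_le_mul h1e1 hCF hCF0 (by norm_num)) (mul_le_mul_of_nonneg_right hcH (by positivity)))
        hlRW
    have hmain : ((1 + ε) ^ 2 * (1 + C) * Λ * (δT / (2 * η) + η / 2)
        + (1 + ε) * (1 + C) * ((1 + ε) * CF + cH * (1 + C) + ℓ * Λ * RW)) / (β₀ * (1 - ε) ^ 2)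
        ≤ (9 / 4 * ((1 + C) * Λ * (MδT / t / (2 * η) + η / 2))
          + 3 / 2 * (1 + C) * (3 / 2 * (MCF / s) + McH / t * (1 + C) + MlRW / t)) / (β₀ / 4) :=
      div_le_div₀ (by positivity) (add_le_add hA hB) (by positivity) h1e'
    have hηterm : 9 * ((1 + C) * Λ * η) / β₀ ≤ 2 / 4800 := by
      rw [hη, div_le_div_iff₀ hβ₀ (by norm_num)]
      have e : 9 * ((1 + C) * Λ * (β₀ / (21600 * (1 + C) * Λ + 1))) * 4800
          = β₀ * (43200 * (1 + C) * Λ / (21600 * (1 + C) * Λ + 1)) := by ring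
      rw [e, mul_comm 2 β₀]
      refine mul_le_mul_of_nonneg_left ?_ hβ₀.le
      rw [div_le_iff₀ (by positivity)]; nlinarith [mul_nonneg (by linarith : (0 : ℝ) ≤ 1 + C) hΛ]
    have e : (9 / 4 * ((1 + C) * Λ * (MδT / t / (2 * η) + η / 2))
          + 3 / 2 * (1 + C) * (3 / 2 * (MCF / s) + McH / t * (1 + C) + MlRW / t)) / (β₀ / 4)
        = 9 * ((1 + C) * Λ * η) / β₀ / 2
          + ((9 * (1 + C) * Λ * MδT / (2 * η * β₀) + 6 * (1 + C) ^ 2 * McH / β₀ + 6 * (1 + C) * MlRW / β₀) / t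
            + 9 * (1 + C) * MCF / β₀ / s) := by
      field_simp; ring
    rw [e] at hmain
    linarith

end Summit.NavierStokesRegularity.NavierStokesRegularity.Theorems.MatchedKernel
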